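import Literature.Computability.AlgebraicComplexity.TwoRowRectangleKronecker
import Literature.RingTheory.SymmetricFunctions.SchurZeroPadding
import Literature.Computability.AlgebraicComplexity.IP17KroneckerPositivityProofs
import HarnessLib

/-!
# Kronecker coefficients of two rectangles of different heights and a two-row shape
# (Ikenmeyer–Panova 2017, Prop. 6.9; discharge of `ikenmeyerPanova2017_prop_6_9` and Cor. 6.10)

Topic `Literature/Computability/AlgebraicComplexity`; a PROOFS file (D-0014): theorems only. It
discharges the named facts `ikenmeyerPanova2017_prop_6_9` and (through the tree's reduction
`ikenmeyerPanova2017_cor_6_10_of_prop_6_9`) `ikenmeyerPanova2017_cor_6_10` of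
`IP17KroneckerPositivity.lean` — C. Ikenmeyer, G. Panova, *Rectangular Kronecker coefficients and
plethysms in geometric complexity theory*, Adv. Math. 319 (2017), Prop. 6.9: for `λ = (a^b)`,
`μ = (c^d)`, `ab = cd = N`, `a ≠ c`: `g(λ, μ, (N-k, k)) = 0` unless `2k = N`, and
`g(λ, μ, (N/2, N/2)) = [(d - b) ∣ d]`.

The printed proof (TeX L1476–1484) is followed: by the master formula
`kroneckerCoeff_rect_rect_twoRow_eq` of `TwoRowRectangleKronecker.lean` (Littlewood's identity and
the Jacobi–Trudi expansion of the two-row character, there obtained through characters),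
`g(λ, μ, (N-k,k)) = E(N-k, k) - E(N-k+1, k-1)` with
`E(r,s) = [x^{λ+ρ_b} y^{μ+ρ_d}] a_{ρ_b}(x) a_{ρ_d}(y) h_r(x⊗y) h_s(x⊗y)` for alphabets of sizes
`b` and `d = b + z`.

1. `coeff_coeff_rect_rect_eq_card`: by Cauchy's identity for alphabets of different sizes
   (`sum_piAntidiag_prod_pow_eq_sum_schur_mul_schur_append`: only `α` with `l(α) ≤ b` occur, padded
   with zeros on the `y` side) and the Littlewood–Richardson rule for rectangles in coefficient
   form (`coeff_rect_alternant_mul_schur`, twice), `E(r,s) = ∑_{α ⊢ s, β ⊢ r} c^{(a^b)}_{βα}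
   c^{(c^d)}_{βα}` is the number of `α ⊢ s` inside both rectangles whose complement `β` in `b × a`
   is also (after padding) its complement in `d × c` ("`β_i = a - α_{b+1-i}`" and
   "`β_i = c - α_{d+1-i}`", TeX L1478–1480).
2. `card_filter_rect_rect_eq`: the printed counting argument (TeX L1480–1484): these constraints
   force `α_j = c` for `j ≤ d-b`, `α_j - α_{j+d-b} = a-c`, whence `α` is unique, exists iff
   `(d-b) ∣ d`, and then `α = β`, so `|α| = N/2`.
3. `ikenmeyerPanova2017_prop_6_9_holds` (the case `b > d` by the symmetry
   `kroneckerCoeff_comm₁₂_holds` and `(d-b) ∣ d ↔ (b-d) ∣ b`), `ikenmeyerPanova2017_cor_6_10_holds`.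

Honest framing (cell val-lit, seat t05): Kronecker combinatorics at rectangles; nothing here bears
on VP ≠ VNP, which is NOT proved.

## References

* [IkenmeyerPanova2017] C. Ikenmeyer, G. Panova, Adv. Math. 319 (2017) 40–66 = arXiv:1512.03798,
  Prop. 6.9 and its proof (TeX L1467–1484), Cor. 6.10 (L1486–1491).
* [PakPanova2014Unimodality] I. Pak, G. Panova, J. Algebraic Combin. 40 (2014), §2 (the
  complement description of `c^{(m^ℓ)}_{αβ}`).
* [Macdonald1995] I. G. Macdonald, *Symmetric Functions and Hall Polynomials*, Ch. I §3–§5.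
-/

noncomputable section

open scoped BigOperators
open MvPolynomial Finset Equiv
open Literature.RingTheory.SymmetricFunctions.SymmPoly
open Literature.RepresentationTheory.FiniteGroups
open Literature.NumberTheory.DiophantineGeometry

namespace Literature.Computability.AlgebraicComplexity

/-! ### 1. `E(r,s)` for two rectangles of different heights -/

/-- One term of Littlewood's identity in `ℤ[y][x]` for alphabets `x = (X_i)_{i<b}`,
`y = (C X_j)_{j<b+z}`: `a_{ρ_b}(x) a_{ρ_{b+z}}(y) (s_β(x) s_{(β,0)}(y)) (s_α(x) s_{(α,0)}(y)) =
P(x) Q(y)`, `P = a_{β+ρ_b} s_α`, `Q = a_{(β,0)+ρ_{b+z}} s_{(α,0)}` (bialternant formula). [folklore] -/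
private theorem alternant_mul_schur_mul_schur_append_eq_map_mul_C {b z : ℕ} (α β : Fin b → ℕ) :
    alternant (fun i => (X i : MvPolynomial (Fin b) (MvPolynomial (Fin (b + z)) ℤ))) (rho b) *
        alternant (fun i => (C (X i) : MvPolynomial (Fin b) (MvPolynomial (Fin (b + z)) ℤ)))
          (rho (b + z)) *
        (schur (fun i => (X i : MvPolynomial (Fin b) (MvPolynomial (Fin (b + z)) ℤ))) β *
            schur (fun i => (C (X i) : MvPolynomial (Fin b) (MvPolynomial (Fin (b + z)) ℤ)))
              (Fin.append β (0 : Fin z → ℕ)) *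
          (schur (fun i => (X i : MvPolynomial (Fin b) (MvPolynomial (Fin (b + z)) ℤ))) α *
            schur (fun i => (C (X i) : MvPolynomial (Fin b) (MvPolynomial (Fin (b + z)) ℤ)))
              (Fin.append α (0 : Fin z → ℕ)))) =
      MvPolynomial.map (C : ℤ →+* MvPolynomial (Fin (b + z)) ℤ)
          (alternant (fun i => (X i : MvPolynomial (Fin b) ℤ)) (β + rho b) *
            schur (fun i => (X i : MvPolynomial (Fin b) ℤ)) α) *
        C (alternant (fun i => (X i : MvPolynomial (Fin (b + z)) ℤ))
              (Fin.append β (0 : Fin z → ℕ) + rho (b + z)) *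
            schur (fun i => (X i : MvPolynomial (Fin (b + z)) ℤ)) (Fin.append α (0 : Fin z → ℕ))) := by
  have hx : (⇑(MvPolynomial.map (C : ℤ →+* MvPolynomial (Fin (b + z)) ℤ)) ∘
      fun i : Fin b => (X i : MvPolynomial (Fin b) ℤ)) =
        fun i => (X i : MvPolynomial (Fin b) (MvPolynomial (Fin (b + z)) ℤ)) :=
    funext fun i => map_X _ i
  have hy : (⇑(C : MvPolynomial (Fin (b + z)) ℤ →+* MvPolynomial (Fin b) (MvPolynomial (Fin (b + z)) ℤ)) ∘
      fun i : Fin (b + z) => (X i : MvPolynomial (Fin (b + z)) ℤ)) =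
        fun i => (C (X i) : MvPolynomial (Fin b) (MvPolynomial (Fin (b + z)) ℤ)) := rfl
  rw [map_mul, map_mul, map_alternant, map_schur, map_alternant, map_schur, hx, hy,
    alternant_add_rho, alternant_add_rho]
  ring

/-- **`E(r,s)` for two rectangles `(a^b)`, `(c^{b+z})`** with `r + s = ab`:
`[x^{a𝟙+ρ_b} y^{c𝟙+ρ_{b+z}}] (a_{ρ_b}(x) a_{ρ_{b+z}}(y) h_r(x⊗y) h_s(x⊗y))
= ∑_{β ⊢ r, α ⊢ s, l ≤ b} c^{(a^b)}_{βα} c^{(c^{b+z})}_{βα}` = the number of antitone `α ∈ ℕ^b`,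
`|α| = s`, inside both rectangles, whose complement `β_i = a - α_{b+1-i}` in `b × a`, padded with
zeros, is its complement `c - α_{b+z+1-i}` in `(b+z) × c` (Cauchy's identity for alphabets of sizes
`b ≤ b + z`, the bialternant formula, and the Littlewood–Richardson rule for rectangles twice).
[cite: IkenmeyerPanova2017, proof of Prop. 6.9 (TeX L1476–1480)] -/
theorem coeff_coeff_rect_rect_eq_card {b z : ℕ} (a c : ℕ) {r s : ℕ} (hrs : r + s = b * a) :
    coeff (Finsupp.equivFunOnFinite.symm fun j => c + rho (b + z) j)
        (coeff (Finsupp.equivFunOnFinite.symm fun j => a + rho b j)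
          (alternant (fun i => (X i : MvPolynomial (Fin b) (MvPolynomial (Fin (b + z)) ℤ))) (rho b) *
            alternant (fun i => (C (X i) : MvPolynomial (Fin b) (MvPolynomial (Fin (b + z)) ℤ)))
              (rho (b + z)) *
            ((∑ M ∈ piAntidiag (univ : Finset (Fin b × Fin (b + z))) r,
                ∏ q : Fin b × Fin (b + z),
                  ((X q.1 : MvPolynomial (Fin b) (MvPolynomial (Fin (b + z)) ℤ)) * C (X q.2)) ^ M q) *
              (∑ M ∈ piAntidiag (univ : Finset (Fin b × Fin (b + z))) s,
                ∏ q : Fin b × Fin (b + z),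
                  ((X q.1 : MvPolynomial (Fin b) (MvPolynomial (Fin (b + z)) ℤ)) * C (X q.2)) ^ M q)))) =
      (((antitoneWeights b s).filter fun α =>
          ((∀ i, α i ≤ a) ∧ ∀ I, Fin.append α (0 : Fin z → ℕ) I ≤ c) ∧
            Fin.append (fun j => a - α (Fin.rev j)) (0 : Fin z → ℕ) =
              fun J => c - Fin.append α (0 : Fin z → ℕ) (Fin.rev J)).card : ℤ) := by
  rw [sum_piAntidiag_prod_pow_eq_sum_schur_mul_schur_append
      (fun i => (X i : MvPolynomial (Fin b) (MvPolynomial (Fin (b + z)) ℤ)))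
      (fun i => (C (X i) : MvPolynomial (Fin b) (MvPolynomial (Fin (b + z)) ℤ))) r,
    sum_piAntidiag_prod_pow_eq_sum_schur_mul_schur_append
      (fun i => (X i : MvPolynomial (Fin b) (MvPolynomial (Fin (b + z)) ℤ)))
      (fun i => (C (X i) : MvPolynomial (Fin b) (MvPolynomial (Fin (b + z)) ℤ))) s,
    Finset.sum_mul_sum, Finset.mul_sum]
  simp_rw [Finset.mul_sum, alternant_mul_schur_mul_schur_append_eq_map_mul_C, coeff_sum,
    coeff_coeff_map_mul_C']
  have hterm : ∀ β ∈ antitoneWeights b r, ∀ α ∈ antitoneWeights b s,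
      coeff (Finsupp.equivFunOnFinite.symm fun j => a + rho b j)
          (alternant (fun i => (X i : MvPolynomial (Fin b) ℤ)) (β + rho b) *
            schur (fun i => (X i : MvPolynomial (Fin b) ℤ)) α) *
        coeff (Finsupp.equivFunOnFinite.symm fun j => c + rho (b + z) j)
          (alternant (fun i => (X i : MvPolynomial (Fin (b + z)) ℤ))
              (Fin.append β (0 : Fin z → ℕ) + rho (b + z)) *
            schur (fun i => (X i : MvPolynomial (Fin (b + z)) ℤ)) (Fin.append α (0 : Fin z → ℕ))) =
        if ((∀ i, α i ≤ a) ∧ β = fun j => a - α (Fin.rev j)) ∧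
            ((∀ I, Fin.append α (0 : Fin z → ℕ) I ≤ c) ∧
              Fin.append β (0 : Fin z → ℕ) =
                fun J => c - Fin.append α (0 : Fin z → ℕ) (Fin.rev J)) then (1 : ℤ) else 0 := by
    intro β hβ α hα
    rw [coeff_rect_alternant_mul_schur a (mem_antitoneWeights.1 hα).2 (mem_antitoneWeights.1 hβ).2,
      coeff_rect_alternant_mul_schur c (antitone_append_zero (mem_antitoneWeights.1 hα).2 z)
        (antitone_append_zero (mem_antitoneWeights.1 hβ).2 z), ite_zero_mul_ite_zero, mul_one]
  rw [Finset.sum_congr rfl fun β hβ => Finset.sum_congr rfl fun α hα => hterm β hβ α hα,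
    Finset.sum_comm, Finset.card_filter, Nat.cast_sum]
  refine Finset.sum_congr rfl fun α hα => ?_
  push_cast
  rw [Finset.sum_eq_single (fun j => a - α (Fin.rev j))]
  · refine if_congr ⟨?_, ?_⟩ rfl rfl
    · rintro ⟨⟨h1, -⟩, h2, h3⟩
      exact ⟨⟨h1, h2⟩, h3⟩
    · rintro ⟨⟨h1, h2⟩, h3⟩
      exact ⟨⟨h1, rfl⟩, h2, h3⟩
  · intro β _ hne
    rw [if_neg]
    rintro ⟨⟨-, h⟩, -⟩
    exact hne h
  · intro hnot
    rw [if_neg]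
    rintro ⟨⟨h1, -⟩, -⟩
    exact hnot (boxCompl_mem_antitoneWeights a hrs hα h1)

/-! ### 2. The counting argument (TeX L1480–1484) -/

/-- Values of a zero-padded weight. [folklore] -/
private theorem append_zero_apply {b z : ℕ} (v : Fin b → ℕ) (J : Fin (b + z)) :
    Fin.append v (0 : Fin z → ℕ) J = if h : (J : ℕ) < b then v ⟨J, h⟩ else 0 := by
  refine Fin.addCases (fun i => ?_) (fun j => ?_) J
  · rw [Fin.append_left, dif_pos (by simp)]
    congr 1
  · rw [Fin.append_right, dif_neg (by simp)]
    rfl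

/-- The complement condition "`β_i = a - α_{b+1-i}` padded equals `c - α_{d+1-i}`", coordinate by
coordinate. [folklore] -/
private theorem fe_iff {b z a c : ℕ} (α : Fin b → ℕ) :
    (Fin.append (fun j => a - α (Fin.rev j)) (0 : Fin z → ℕ) =
        fun J => c - Fin.append α (0 : Fin z → ℕ) (Fin.rev J)) ↔
      ∀ n (hn : n < b + z),
        (if h : n < b then a - α (Fin.rev ⟨n, h⟩) else 0) =
          c - if h : b + z - (n + 1) < b then α ⟨b + z - (n + 1), h⟩ else 0 := by
  rw [funext_iff, Fin.forall_iff]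
  refine forall₂_congr fun n hn => ?_
  rw [append_zero_apply, append_zero_apply, Fin.val_rev]

/-- **The constraints force `α`** (TeX L1480–1484: "`α_j = c` for `j ≤ d-b`", "`α_j - α_{j+d-b} =
a - c`", "`α_b = a - c`, we must have `(d-b) | d`"): if `α ≤ c` and the padded `b × a`-complement
of `α` is its `(b+z) × c`-complement, then `z ∣ b`, `(b/z)(a-c) = c` and
`α_i = c - ⌊i/z⌋ (a - c)`. [cite: IkenmeyerPanova2017, proof of Prop. 6.9 (TeX L1480–1484)] -/
theorem rect_rect_complement_forced {b z a c : ℕ} (hz : 1 ≤ z) (hb : 1 ≤ b) (hc : 1 ≤ c)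
    (hca : c < a) {α : Fin b → ℕ} (hαc : ∀ i, α i ≤ c)
    (hFE : Fin.append (fun j => a - α (Fin.rev j)) (0 : Fin z → ℕ) =
      fun J => c - Fin.append α (0 : Fin z → ℕ) (Fin.rev J)) :
    z ≤ b ∧ z ∣ b ∧ b / z * (a - c) = c ∧ ∀ i : Fin b, α i + (i : ℕ) / z * (a - c) = c := by
  rw [fe_iff] at hFE
  have hαeq : ∀ (n : ℕ) (h : n < b) (i : Fin b), n = i → α ⟨n, h⟩ = α i := by
    rintro n h i rfl; rfl
  have hαrev : ∀ (n : ℕ) (h : n < b) (i : Fin b), b - (n + 1) = i → α (Fin.rev ⟨n, h⟩) = α i := by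
    intro n h i hi
    congr 1
    exact Fin.ext (by rw [Fin.val_rev]; exact hi)
  -- `z ≤ b`
  have hzb : z ≤ b := by
    by_contra hlt
    have h := hFE (z - 1) (by omega)
    rw [dif_neg (by omega), dif_neg (by omega)] at h
    omega
  -- `α_i = c` for `i < z`
  have hA : ∀ i : Fin b, (i : ℕ) < z → α i = c := by
    intro i hi
    have h := hFE (b + z - 1 - i) (by omega)
    rw [dif_neg (by omega), dif_pos (by omega),
      hαeq (b + z - (b + z - 1 - (i : ℕ) + 1)) _ i (by omega)] at h
    have := hαc i
    omega
  -- `α_i = α_{i+z} + (a - c)` for `i + z < b`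
  have hB : ∀ i j : Fin b, (j : ℕ) = i + z → α i = α j + (a - c) := by
    intro i j hij
    have h := hFE (b - 1 - i) (by omega)
    rw [dif_pos (by omega), hαrev _ _ i (by omega), dif_pos (by omega),
      hαeq (b + z - (b - 1 - (i : ℕ) + 1)) _ j (by omega)] at h
    have := hαc i
    have := hαc j
    omega
  -- `α_i = a - c` for `i + z ≥ b`
  have hC : ∀ i : Fin b, b ≤ (i : ℕ) + z → α i = a - c := by
    intro i hi
    have h := hFE (b - 1 - i) (by omega)
    rw [dif_pos (by omega), hαrev _ _ i (by omega), dif_neg (by omega)] at h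
    have := hαc i
    omega
  -- the closed formula
  have hind : ∀ m, ∀ i : Fin b, (i : ℕ) = m → α i + m / z * (a - c) = c := by
    intro m
    induction m using Nat.strong_induction_on with
    | _ m ih =>
      intro i him
      by_cases hm : m < z
      · rw [Nat.div_eq_of_lt hm, zero_mul, add_zero]
        exact hA i (him ▸ hm)
      · have hzm : z ≤ m := not_lt.mp hm
        have hj := ih (m - z) (by omega) ⟨m - z, by omega⟩ rfl
        have hb' := hB ⟨m - z, by omega⟩ i (by simp; omega)
        have h1 := Nat.sub_mul_div m z 1
        rw [mul_one] at h1
        have h2 := Nat.div_pos hzm (by omega)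
        have hdiv : m / z = (m - z) / z + 1 := by omega
        rw [hdiv, add_mul, one_mul]
        omega
  -- divisibility
  have h1 := hind (b - 1) ⟨b - 1, by omega⟩ rfl
  have h2 := hind (b - z) ⟨b - z, by omega⟩ rfl
  rw [hC ⟨b - 1, by omega⟩ (by simp; omega)] at h1
  rw [hC ⟨b - z, by omega⟩ (by show b ≤ b - z + z; omega)] at h2
  have h3 : (b - 1) / z * (a - c) = (b - z) / z * (a - c) := by omega
  have h4 : (b - 1) / z = (b - z) / z := Nat.eq_of_mul_eq_mul_right (by omega) h3
  have h5 := Nat.sub_mul_div b z 1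
  rw [mul_one] at h5
  have h6 := Nat.div_pos hzb (by omega)
  have h7 : b / z = (b - 1) / z + if z ∣ b then 1 else 0 := by
    have := @Nat.succ_div (b - 1) z
    rwa [Nat.sub_add_cancel hb] at this
  have hdvd : z ∣ b := by
    by_contra hnd
    rw [if_neg hnd] at h7
    omega
  refine ⟨hzb, hdvd, ?_, fun i => hind i i rfl⟩
  rw [if_pos hdvd] at h7
  have h8 : (b - z) / z * (a - c) = b / z * (a - c) - (a - c) := by
    rw [h5, Nat.sub_one_mul]
  have h9 : a - c ≤ b / z * (a - c) := Nat.le_mul_of_pos_left _ h6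
  omega

/-- The complement condition is symmetric in `α ↔ β`: the complement `β` of `α` satisfies it too
("it is easy to see that `α = β`", TeX L1484). [folklore] -/
private theorem rect_rect_complement_swap {b z a c : ℕ} {α β : Fin b → ℕ} (hαa : ∀ i, α i ≤ a)
    (hαc : ∀ I, Fin.append α (0 : Fin z → ℕ) I ≤ c)
    (hFE : Fin.append β (0 : Fin z → ℕ) = fun J => c - Fin.append α (0 : Fin z → ℕ) (Fin.rev J))
    (hβ : β = fun j => a - α (Fin.rev j)) :
    (∀ i, β i ≤ c) ∧
      Fin.append (fun j => a - β (Fin.rev j)) (0 : Fin z → ℕ) =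
        fun J => c - Fin.append β (0 : Fin z → ℕ) (Fin.rev J) := by
  constructor
  · intro i
    have h := congrFun hFE (Fin.castAdd z i)
    rw [Fin.append_left] at h
    rw [h]
    exact Nat.sub_le _ _
  · have hKa : (fun j => a - β (Fin.rev j)) = α := by
      subst hβ
      exact boxCompl_boxCompl a hαa
    rw [hKa, hFE]
    exact (boxCompl_boxCompl c hαc).symm

/-- **The count** (TeX L1480–1484): for `1 ≤ z`, `1 ≤ b`, `1 ≤ c < a` with `ab = c(b+z)`, the
number of antitone `α ∈ ℕ^b` with `|α| = s` inside both rectangles whose padded `b × a`-complement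
is its `(b+z) × c`-complement is `1` if `z ∣ b` and `2s = ab`, and `0` otherwise (the unique
solution is `α_i = c - ⌊i/z⌋(a-c)`, which equals its own complement, so `|α| = ab/2`).
[cite: IkenmeyerPanova2017, proof of Prop. 6.9 (TeX L1480–1484)] -/
theorem card_filter_rect_rect_eq {b z a c s : ℕ} (hz : 1 ≤ z) (hb : 1 ≤ b) (hc : 1 ≤ c)
    (hca : c < a) (hN : a * b = c * (b + z)) :
    ((antitoneWeights b s).filter fun α =>
        ((∀ i, α i ≤ a) ∧ ∀ I, Fin.append α (0 : Fin z → ℕ) I ≤ c) ∧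
          Fin.append (fun j => a - α (Fin.rev j)) (0 : Fin z → ℕ) =
            fun J => c - Fin.append α (0 : Fin z → ℕ) (Fin.rev J)).card =
      if z ∣ b ∧ 2 * s = a * b then 1 else 0 := by
  -- uniqueness: a member is the forced weight, and `z ∣ b`, `2s = ab`
  have hU : ∀ α ∈ (antitoneWeights b s).filter fun α =>
        ((∀ i, α i ≤ a) ∧ ∀ I, Fin.append α (0 : Fin z → ℕ) I ≤ c) ∧
          Fin.append (fun j => a - α (Fin.rev j)) (0 : Fin z → ℕ) =
            fun J => c - Fin.append α (0 : Fin z → ℕ) (Fin.rev J),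
      (z ∣ b ∧ 2 * s = a * b) ∧ α = fun i : Fin b => c - (i : ℕ) / z * (a - c) := by
    intro α hα
    rw [Finset.mem_filter, mem_antitoneWeights] at hα
    obtain ⟨⟨hsum, -⟩, ⟨hαa, hαc⟩, hFE⟩ := hα
    have hαc' : ∀ i, α i ≤ c := fun i => by
      have := hαc (Fin.castAdd z i); rwa [Fin.append_left] at this
    obtain ⟨-, hdvd, -, hform⟩ := rect_rect_complement_forced hz hb hc hca hαc' hFE
    -- the complement satisfies the same constraints, hence equals `α`
    obtain ⟨hβc, hβFE⟩ := rect_rect_complement_swap hαa hαc hFE rfl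
    obtain ⟨-, -, -, hformβ⟩ := rect_rect_complement_forced hz hb hc hca hβc hβFE
    have hβα : ∀ j : Fin b, a - α (Fin.rev j) = α j := fun j => by
      have := hform j; have := hformβ j; omega
    have h2 := sum_boxCompl_add a hαa
    rw [Finset.sum_congr rfl fun j _ => hβα j, hsum] at h2
    refine ⟨⟨hdvd, by have := Nat.mul_comm a b; omega⟩, funext fun i => ?_⟩
    · have := hform i; omega
  split_ifs with h
  · obtain ⟨hdvd, hs⟩ := h
    rw [Finset.card_eq_one]
    refine ⟨fun i : Fin b => c - (i : ℕ) / z * (a - c), Finset.eq_singleton_iff_unique_mem.2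
      ⟨?_, fun α hα => (hU α hα).2⟩⟩
    -- existence: the forced weight satisfies the constraints
    have hzb : z ≤ b := Nat.le_of_dvd (by omega) hdvd
    obtain ⟨k, hk⟩ := hdvd
    have hkz : b / z = k := by rw [hk, Nat.mul_div_cancel_left k (by omega)]
    have hk1 : 1 ≤ k := by
      rcases Nat.eq_zero_or_pos k with h0 | h0
      · subst h0; simp at hk; omega
      · exact h0
    have hkt : k * (a - c) = c := by
      have h1 : z * (a * k) = z * (c * k + c) := by
        rw [hk] at hN
        calc z * (a * k) = a * (z * k) := by ring
          _ = c * (z * k + z) := hN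
          _ = z * (c * k + c) := by ring
      have h2 := Nat.eq_of_mul_eq_mul_left (by omega) h1
      rw [Nat.mul_sub, Nat.mul_comm k a, Nat.mul_comm k c]
      omega
    -- the complement condition for the forced weight
    have hFE0 : Fin.append (fun j => a - (fun i : Fin b => c - (i : ℕ) / z * (a - c)) (Fin.rev j))
        (0 : Fin z → ℕ) = fun J => c - Fin.append (fun i : Fin b => c - (i : ℕ) / z * (a - c))
          (0 : Fin z → ℕ) (Fin.rev J) := by
      refine (fe_iff (z := z) (a := a) (c := c)
        (fun i : Fin b => c - (i : ℕ) / z * (a - c))).2 fun n hn => ?_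
      by_cases h1 : n < b
      · rw [dif_pos h1]
        simp only [Fin.val_rev]
        by_cases h2 : b + z - (n + 1) < b
        · rw [dif_pos h2]
          have hq : (b + z - (n + 1)) / z = (b - (n + 1)) / z + 1 := by
            rw [show b + z - (n + 1) = b - (n + 1) + z by omega, Nat.add_div_right _ (by omega)]
          have hlt : (b - (n + 1)) / z + 1 < k := by
            rw [← hq, Nat.div_lt_iff_lt_mul (by omega)]
            have := Nat.mul_comm z k
            omega
          have hle : ((b - (n + 1)) / z + 2) * (a - c) ≤ k * (a - c) :=
            Nat.mul_le_mul_right _ (by omega)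
          rw [hq, add_mul, one_mul]
          rw [add_mul] at hle
          omega
        · rw [dif_neg h2, Nat.sub_zero]
          have hq : (b - (n + 1)) / z = k - 1 :=
            Nat.div_eq_of_lt_le (by rw [Nat.sub_one_mul]; have := Nat.mul_comm z k; omega)
              (by rw [Nat.sub_add_cancel hk1]; have := Nat.mul_comm z k; omega)
          rw [hq, Nat.sub_one_mul]
          have : a - c ≤ k * (a - c) := Nat.le_mul_of_pos_left _ hk1
          omega
      · rw [dif_neg h1, dif_pos (by omega)]
        dsimp only
        rw [Nat.div_eq_of_lt (by omega), zero_mul, Nat.sub_zero, Nat.sub_self]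
    have hle0 : ∀ i : Fin b, (i : ℕ) / z * (a - c) + (a - c) ≤ c := fun i => by
      have hlt : (i : ℕ) / z < k := by
        rw [Nat.div_lt_iff_lt_mul (by omega)]
        have hi : (i : ℕ) < z * k := by rw [← hk]; exact i.2
        linarith [Nat.mul_comm z k]
      have := Nat.mul_le_mul_right (a - c) (show (i : ℕ) / z + 1 ≤ k by omega)
      rw [add_mul, one_mul, hkt] at this
      exact this
    have h0a : ∀ i : Fin b, (fun i : Fin b => c - (i : ℕ) / z * (a - c)) i ≤ a := fun i => by
      dsimp only; omega
    have h0c : ∀ I, Fin.append (fun i : Fin b => c - (i : ℕ) / z * (a - c)) (0 : Fin z → ℕ) I ≤ c :=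
      fun I => by rw [append_zero_apply]; split_ifs <;> simp
    rw [Finset.mem_filter, mem_antitoneWeights]
    refine ⟨⟨?_, ?_⟩, ⟨h0a, h0c⟩, hFE0⟩
    · -- the sum: the forced weight is its own complement
      obtain ⟨hβc, hβFE⟩ := rect_rect_complement_swap h0a h0c hFE0 rfl
      obtain ⟨-, -, -, hformβ⟩ := rect_rect_complement_forced hz hb hc hca hβc hβFE
      have hβα : ∀ j : Fin b, a - (fun i : Fin b => c - (i : ℕ) / z * (a - c)) (Fin.rev j) =
          (fun i : Fin b => c - (i : ℕ) / z * (a - c)) j := fun j => by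
        have h1 := hformβ j
        have h2 := hle0 j
        dsimp only at h1 h2 ⊢
        omega
      have h2 := sum_boxCompl_add a h0a
      rw [Finset.sum_congr rfl fun j _ => hβα j] at h2
      have := Nat.mul_comm a b
      omega
    · intro i j hij
      dsimp only
      exact Nat.sub_le_sub_left (Nat.mul_le_mul_right _ (Nat.div_le_div_right hij)) _
  · rw [Finset.card_eq_zero, Finset.eq_empty_iff_forall_notMem]
    exact fun α hα => h (hU α hα).1

/-! ### 3. Prop. 6.9 and Cor. 6.10 -/

/-- The sorted parts of a partition with `m` parts equal to `v`. [folklore] -/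
private theorem sortedParts_of_parts_eq_replicate {N m v : ℕ} (μ : Nat.Partition N)
    (h : μ.parts = Multiset.replicate m v) : μ.sortedParts = List.replicate m v := by
  rw [Nat.Partition.sortedParts, h, ← Multiset.coe_replicate, Multiset.coe_sort]
  apply List.mergeSort_eq_self
  rw [List.pairwise_replicate]
  exact Or.inr (by simp)

/-- **Prop. 6.9 for `b < d = b + z`** (the rectangle `(a^b)` in `b` letters on the `x` side,
`(c^{b+z})` in `b + z` letters on the `y` side): for `1 ≤ k ≤ N/2`,
`g((a^b), (c^{b+z}), (N-k,k)) = [z ∣ b ∧ 2k = N]` — the master formula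
`kroneckerCoeff_rect_rect_twoRow_eq`, `coeff_coeff_rect_rect_eq_card` and the count
`card_filter_rect_rect_eq` (the subtracted term `E(N-k+1, k-1)` vanishes since `2(k-1) ≠ N`).
[cite: IkenmeyerPanova2017, Prop. 6.9 (TeX L1467–1484)] -/
theorem kroneckerCoeff_rect_rect_twoRow_of_lt {N a b c z k : ℕ} (hab : a * b = N)
    (hcd : c * (b + z) = N) (hz : 1 ≤ z) (hk : 1 ≤ k) (hkN : 2 * k ≤ N)
    (lam mu : Nat.Partition N) (hlam : lam.parts = Multiset.replicate b a)
    (hmu : mu.parts = Multiset.replicate (b + z) c) :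
    kroneckerCoeff ℂ lam mu (Nat.Partition.twoRow N k (by omega)) =
      if z ∣ b ∧ 2 * k = N then 1 else 0 := by
  -- positivity of the parameters
  have hb : 1 ≤ b := by
    rcases Nat.eq_zero_or_pos b with h | h
    · subst h; simp at hab; omega
    · exact h
  have hc : 1 ≤ c := by
    rcases Nat.eq_zero_or_pos c with h | h
    · subst h; simp at hcd; omega
    · exact h
  have hN : a * b = c * (b + z) := hab.trans hcd.symm
  have hca : c < a := by
    by_contra hle
    have h1 : a * b ≤ c * b := Nat.mul_le_mul_right b (not_lt.mp hle)
    have h2 : c * (b + z) = c * b + c * z := by ring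
    have h3 : 1 ≤ c * z := Nat.one_le_iff_ne_zero.mpr (Nat.mul_ne_zero (by omega) (by omega))
    omega
  -- the padded parts vectors
  have hRb : lam.parts.card ≤ b := by rw [hlam, Multiset.card_replicate]
  have hR'd : mu.parts.card ≤ b + z := by rw [hmu, Multiset.card_replicate]
  have hR : ∀ j : Fin b, lam.sortedParts.getD j 0 = a := fun j => by
    rw [sortedParts_of_parts_eq_replicate lam hlam, List.getD_replicate _ j.2]
  have hR' : ∀ j : Fin (b + z), mu.sortedParts.getD j 0 = c := fun j => by
    rw [sortedParts_of_parts_eq_replicate mu hmu, List.getD_replicate _ j.2]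
  have key := kroneckerCoeff_rect_rect_twoRow_eq a c lam mu hRb hR hR'd hR' hkN
  rw [if_neg (by omega),
    coeff_coeff_rect_rect_eq_card a c (r := N - k) (s := k) (by rw [← hab, Nat.mul_comm b a]; omega),
    coeff_coeff_rect_rect_eq_card a c (r := N - k + 1) (s := k - 1)
      (by rw [← hab, Nat.mul_comm b a]; omega),
    card_filter_rect_rect_eq hz hb hc hca hN, card_filter_rect_rect_eq hz hb hc hca hN,
    if_neg (show ¬(z ∣ b ∧ 2 * (k - 1) = a * b) by omega), Nat.cast_zero, sub_zero] at key
  rw [hab] at key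
  exact_mod_cast key

/-- The divisibility condition of Prop. 6.9 for `d = b + z`: `(d - b) ∣ d ↔ z ∣ b` (in `ℤ`).
[folklore] -/
private theorem sub_dvd_iff_left (b z : ℕ) :
    ((b + z : ℕ) : ℤ) - (b : ℤ) ∣ ((b + z : ℕ) : ℤ) ↔ z ∣ b := by
  push_cast
  rw [add_sub_cancel_left, dvd_add_left (dvd_refl _), Int.natCast_dvd_natCast]

/-- The divisibility condition of Prop. 6.9 for `b = d + z`: `(d - b) ∣ d ↔ z ∣ d` (in `ℤ`).
[folklore] -/
private theorem sub_dvd_iff_right (d z : ℕ) :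
    (d : ℤ) - ((d + z : ℕ) : ℤ) ∣ (d : ℤ) ↔ z ∣ d := by
  push_cast
  rw [show (d : ℤ) - (d + z) = -z by ring, neg_dvd, Int.natCast_dvd_natCast]

/-- **Discharge of `ikenmeyerPanova2017_prop_6_9`** (Ikenmeyer–Panova 2017, Prop. 6.9): for
`λ = (a^b)`, `μ = (c^d)`, `ab = cd = N`, `a ≠ c`, `1 ≤ k ≤ N/2`: `g(λ, μ, (N-k,k)) = 0` if
`2k ≠ N`, and `= [(d-b) ∣ d]` if `2k = N`. The case `b < d` is
`kroneckerCoeff_rect_rect_twoRow_of_lt`; the case `b > d` follows by the symmetry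
`g(λ, μ, ν) = g(μ, λ, ν)` (`kroneckerCoeff_comm₁₂_holds`) and `(d-b) ∣ d ↔ (b-d) ∣ b`.
[cite: IkenmeyerPanova2017, Prop. 6.9 (TeX L1467–1484; held: Proposition 33, chunk p0017)] -/
theorem ikenmeyerPanova2017_prop_6_9_holds : ikenmeyerPanova2017_prop_6_9 := by
  intro N a b c d k hab hcd hac hk hkN lam mu nu hlam hmu hnu
  -- `ν = (N - k, k)`
  have hnu' : nu = Nat.Partition.twoRow N k (by omega) := by
    refine Nat.Partition.ext ?_
    rw [hnu]
    simp only [Nat.Partition.twoRow, Nat.Partition.ofSums]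
    symm
    rw [Multiset.filter_eq_self]
    intro x hx
    have : x = N - k ∨ x = k := by simpa using hx
    omega
  subst hnu'
  have hb : 1 ≤ b := by
    rcases Nat.eq_zero_or_pos b with h | h
    · subst h; simp at hab; omega
    · exact h
  have hbd : b ≠ d := by
    intro h
    subst h
    exact hac (Nat.eq_of_mul_eq_mul_right hb (hab.trans hcd.symm))
  rcases Nat.lt_or_gt_of_ne hbd with hlt | hgt
  · -- `b < d = b + z`
    obtain ⟨z, rfl⟩ := Nat.exists_eq_add_of_le hlt.le
    have hz : 1 ≤ z := by omega
    have key := kroneckerCoeff_rect_rect_twoRow_of_lt hab hcd hz hk hkN lam mu hlam hmu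
    refine ⟨fun hne => ?_, fun heq => ?_⟩
    · rw [key, if_neg]
      rintro ⟨-, h⟩
      exact hne h
    · rw [key]
      by_cases hzb : z ∣ b
      · rw [if_pos ⟨hzb, heq⟩, if_pos ((sub_dvd_iff_left b z).2 hzb)]
      · rw [if_neg (fun h => hzb h.1), if_neg (fun h => hzb ((sub_dvd_iff_left b z).1 h))]
  · -- `d < b = d + z`: swap the rectangles
    obtain ⟨z, rfl⟩ := Nat.exists_eq_add_of_le hgt.le
    have hz : 1 ≤ z := by omega
    have key := kroneckerCoeff_rect_rect_twoRow_of_lt hcd hab hz hk hkN mu lam hmu hlam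
    rw [kroneckerCoeff_comm₁₂_holds ℂ lam mu]
    refine ⟨fun hne => ?_, fun heq => ?_⟩
    · rw [key, if_neg]
      rintro ⟨-, h⟩
      exact hne h
    · rw [key]
      by_cases hzd : z ∣ d
      · rw [if_pos ⟨hzd, heq⟩, if_pos ((sub_dvd_iff_right d z).2 hzd)]
      · rw [if_neg (fun h => hzd h.1), if_neg (fun h => hzd ((sub_dvd_iff_right d z).1 h))]

/-- **Discharge of `ikenmeyerPanova2017_cor_6_10`** (Ikenmeyer–Panova 2017, Cor. 6.10: two
columns against `n × d`, `n ≠ d`), by the tree's printed reduction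
`ikenmeyerPanova2017_cor_6_10_of_prop_6_9` and Prop. 6.9.
[cite: IkenmeyerPanova2017, Cor. 6.10 (TeX L1486–1491; held: Corollary 34, chunk p0017)] -/
theorem ikenmeyerPanova2017_cor_6_10_holds : ikenmeyerPanova2017_cor_6_10 :=
  ikenmeyerPanova2017_cor_6_10_of_prop_6_9 ikenmeyerPanova2017_prop_6_9_holds

end Literature.Computability.AlgebraicComplexity
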